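import Summits.RiemannHypothesis.RiemannHypothesis.Theses.WeilComb
import Summits.RiemannHypothesis.RiemannHypothesis.Theorems.WeilCombCombSubcriticalStubIdentity
import Summits.RiemannHypothesis.RiemannHypothesis.Theorems.WeilCombCombSubcriticalStubPoincare
import Summits.RiemannHypothesis.RiemannHypothesis.Theorems.WeilCombCombSubcriticalStubCore
import Summits.RiemannHypothesis.RiemannHypothesis.Theorems.WeilCombCombSubcriticalStubAutocorrelation
import Summits.RiemannHypothesis.RiemannHypothesis.Theorems.WeilCombCombSubcriticalStubPolar
import Summits.RiemannHypothesis.RiemannHypothesis.Theorems.WeilCombCombSubcriticalStubPrime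
import Summits.RiemannHypothesis.RiemannHypothesis.Theorems.WeilCombCombSubcriticalStubArchDiag
import Summits.RiemannHypothesis.RiemannHypothesis.Theorems.WeilCombCombSubcriticalStubArchOffdiag
import Summits.RiemannHypothesis.RiemannHypothesis.Theorems.WeilCombCombSubcriticalStubArch
import Literature.NumberTheory.LFunctions.WeilExplicit
import Literature.NumberTheory.LFunctions.WeilArchimedeanMoments
import Literature.NumberTheory.LFunctions.WeilMellinBounds
import Literature.NumberTheory.LFunctions.WeilGroundEnergyProofs

/-!
# `WeilComb.CombSubcritical` ("Theorem A") — line `helson-dirichlet-slack`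
(item stmt-RiemannHypothesis-1025, route route-RiemannHypothesis-WeilComb)

THEOREM A (crux #3 of route WeilComb, unconditional): there is a universal `c₀ > 0` such that for
every Weil test `φ` with `tsupport φ ⊆ [-1, 1]`, every `ε > 0`, `M : ℕ`, `a : ℕ → ℂ` with
`ε·M ≤ c₀`, the log-integer comb `g(x) = Σ_{m ≤ M} a_m ε⁻¹ φ((x − log m)/ε)` has
`Re W(g ⋆ g̃) ≥ 0` (Weil positivity on a cone of tests of unbounded support, proved without zeros).

This file is the sorry-free composition of the line's nine landed stub files (all in this
namespace, imported above):
* arithmetic half — `stub_identity` (ground-state identity of the Λ-Helson form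
  `⟨S_M a,a⟩ = Σ_m ‖a_m‖²(log m + ψ₁(M/m)) − D(a)`), `stub_poincare` (multiscale Poincaré
  inequality `Σ m log m ‖a_m‖² ≤ 2M·D + C·M‖a‖²`), `stub_core` (the transfer:
  `∀ C ∃ c₀ ≤ 1/8 ∀ M ≥ 1 ∀ a, ⟨S_M a,a⟩ + (c₀/M)·archShadow(a) ≤ (log M + log(1/c₀) − C)‖a‖²`);
* analytic half — `stub_autocorrelation` (`g ⋆ g̃ = Σ_{m,m'} a_m conj(a_{m'}) τ_{log m − log m'} ψ_ε`),
  `stub_polar` (`Re(k̂(0) + k̂(1)) ≥ −5‖φ‖₂² A₋A₊`), `stub_prime` (prime term EXACTLY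
  `ε⁻¹‖φ‖₂²⟨S_M a,a⟩` for `8εM ≤ 1`), `stub_archDiag` (sharp diagonal
  `Re W_∞(h ⋆ h̃) ≥ (log(1/b) − 7)‖h‖₂²`), `stub_archOffdiag` (`|W_∞(τ_x ψ_ε)| ≤ ‖φ‖₁²(1/|x| + 1)`),
  `stub_arch` (`Re W_∞(k) ≥ ε⁻¹‖φ‖₂²(log(1/ε) − C)‖a‖² − 2‖φ‖₂²(B_abs + ‖a‖₁²)`).
Here `analyticReduction` assembles `W = polar − prime + arch` into
`Re Q(g) ≥ ε⁻¹‖φ‖₂²·[(log(1/ε) − C)‖a‖² − ⟨S_M a,a⟩ − ε·archShadow(a)]`, and `CombSubcritical_of`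
glues it with the core: take `c₀ ≤ 1/8` from the core at the reduction's `C`; for `M ≥ 1`,
`εM ≤ c₀` gives `8εM ≤ 1`, `ε ≤ c₀/M` and `log(1/ε) ≥ log M + log(1/c₀)`; `M = 0` is `Q(0) = 0`.

Dictionary (all verbatim expansions, no local `def`):
* `helsonForm M a`      ↦ `2 * (∑ m ∈ Icc 1 M, ∑ n ∈ Icc 1 (M / m), Λ(n)/√n · a (n m) · conj (a m)).re`
* `l2 M a`              ↦ `∑ m ∈ Icc 1 M, ‖a m‖²`;  `Aminus`, `Aplus` ↦ `∑ ‖a m‖/√m`, `∑ ‖a m‖ √m`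
* `logHilbertAbs M a`   ↦ `∑ m ∈ Icc 1 M, ∑ m' ∈ (Icc 1 M).erase m, ‖a m‖ ‖a m'‖ / |log m − log m'|`
* `archShadow M a`      ↦ `5 Aminus Aplus + 2 logHilbertAbs + 2 (∑ ‖a m‖)²`
* `comb φ ε M a`        ↦ `fun x ↦ ∑ m ∈ Icc 1 M, a m * ((ε:ℂ)⁻¹ * φ ((x − log m)/ε))` (the crux's function)

Idea (crux idea card `Cruxes/CombSubcritical/Ideas/helson-dirichlet-slack.md`, line card
`Cruxes/CombSubcritical/Lines/helson-dirichlet-slack.md`): complete the square along every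
prime-power edge `m → nm` of the divisor graph in the Perron gauge `n^{-1/2}`; the Dirichlet-energy
slack of the Helson form pays, through the Poincaré inequality, the archimedean beam and the
rank-2 pole of the exact Weil form evaluated on the comb autocorrelation.
-/

noncomputable section

open scoped BigOperators ComplexConjugate
open Complex MeasureTheory Set

namespace Summit.RiemannHypothesis.RiemannHypothesis.Theorems.WeilCombSubcritical

open Literature.NumberTheory.LFunctions

/-! ### The composition (concludes the crux BY NAME) -/

/-- **The analytic reduction** (from `stub_polar`, `stub_prime`, `stub_arch` and
`stub_autocorrelation`): for a Weil test `φ` supported in `[-1,1]`, `0 < ε`, `M ≥ 1`, `8εM ≤ 1`,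
`Re Q(g) ≥ ε⁻¹‖φ‖₂²·[(log(1/ε) − C)‖a‖² − ⟨S_M a,a⟩ − ε·archShadow(a)]` with an ABSOLUTE `C`
(`Q(g) = W(g ⋆ g̃) = polar − prime + arch`, by definition). -/
theorem analyticReduction :
    ∃ C : ℝ, ∀ φ : ℝ → ℂ, IsWeilTest φ → tsupport φ ⊆ Set.Icc (-1) 1 →
      ∀ ε : ℝ, 0 < ε → ∀ (M : ℕ) (a : ℕ → ℂ), 1 ≤ M → 8 * ε * M ≤ 1 →
        ε⁻¹ * weilNorm2Sq φ *
            ((Real.log (1 / ε) - C) * (∑ m ∈ Finset.Icc 1 M, ‖a m‖ ^ 2) -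
              2 * (∑ m ∈ Finset.Icc 1 M, ∑ n ∈ Finset.Icc 1 (M / m),
                ((ArithmeticFunction.vonMangoldt n : ℝ) : ℂ) / (Real.sqrt n : ℂ) * a (n * m) *
                  conj (a m)).re -
              ε * (5 * (∑ m ∈ Finset.Icc 1 M, ‖a m‖ / Real.sqrt m) *
                    (∑ m ∈ Finset.Icc 1 M, ‖a m‖ * Real.sqrt m) +
                  2 * (∑ m ∈ Finset.Icc 1 M, ∑ m' ∈ (Finset.Icc 1 M).erase m,
                    ‖a m‖ * ‖a m'‖ / |Real.log m - Real.log m'|) +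
                  2 * (∑ m ∈ Finset.Icc 1 M, ‖a m‖) ^ 2)) ≤
          (weilQuadratic (fun x : ℝ => ∑ m ∈ Finset.Icc 1 M,
            a m * ((ε : ℂ)⁻¹ * φ ((x - Real.log (m : ℝ)) / ε)))).re := by
  obtain ⟨C, hC⟩ := stub_arch stub_autocorrelation
  refine ⟨C, fun φ hφ hsupp ε hε M a hM h8 => ?_⟩
  have hMr : (1 : ℝ) ≤ (M : ℝ) := by exact_mod_cast hM
  have hε8 : ε ≤ 1 / 8 := by nlinarith
  have hP := stub_polar φ hφ hsupp ε hε hε8 M a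
  have hPr := stub_prime stub_autocorrelation φ hφ hsupp ε hε M a hM h8
  have hA := hC φ hφ hsupp ε hε M a hM h8
  -- names for the real atoms
  set N : ℝ := weilNorm2Sq φ with hN
  set H : ℝ := 2 * (∑ m ∈ Finset.Icc 1 M, ∑ n ∈ Finset.Icc 1 (M / m),
      ((ArithmeticFunction.vonMangoldt n : ℝ) : ℂ) / (Real.sqrt n : ℂ) * a (n * m) *
        conj (a m)).re with hH
  set L : ℝ := ∑ m ∈ Finset.Icc 1 M, ‖a m‖ ^ 2 with hL
  set Am : ℝ := ∑ m ∈ Finset.Icc 1 M, ‖a m‖ / Real.sqrt m with hAm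
  set Ap : ℝ := ∑ m ∈ Finset.Icc 1 M, ‖a m‖ * Real.sqrt m with hAp
  set B : ℝ := ∑ m ∈ Finset.Icc 1 M, ∑ m' ∈ (Finset.Icc 1 M).erase m,
      ‖a m‖ * ‖a m'‖ / |Real.log m - Real.log m'| with hB
  set A1 : ℝ := ∑ m ∈ Finset.Icc 1 M, ‖a m‖ with hA1
  set k : ℝ → ℂ := weilConv (fun x : ℝ => ∑ m ∈ Finset.Icc 1 M,
      a m * ((ε : ℂ)⁻¹ * φ ((x - Real.log (m : ℝ)) / ε)))
    (weilReflect (fun x : ℝ => ∑ m ∈ Finset.Icc 1 M,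
      a m * ((ε : ℂ)⁻¹ * φ ((x - Real.log (m : ℝ)) / ε)))) with hk
  have hQ : (weilQuadratic (fun x : ℝ => ∑ m ∈ Finset.Icc 1 M,
      a m * ((ε : ℂ)⁻¹ * φ ((x - Real.log (m : ℝ)) / ε)))).re =
      (weilPolarTerm k).re - (weilPrimeTerm k).re + (weilArchTerm k).re := by
    simp only [weilQuadratic, weilFunctional, hk, Complex.add_re, Complex.sub_re]
  rw [hQ, hPr, Complex.ofReal_re]
  have e : ε⁻¹ * N * ((Real.log (1 / ε) - C) * L - H - ε * (5 * Am * Ap + 2 * B + 2 * A1 ^ 2)) =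
      ε⁻¹ * N * ((Real.log (1 / ε) - C) * L) - ε⁻¹ * N * H -
        (5 * N * Am * Ap + 2 * N * (B + A1 ^ 2)) := by
    field_simp
    ring
  rw [e]
  linarith [hP, hA]

/-- **THEOREM A — `WeilComb.CombSubcritical`.** The arithmetic core (`stub_identity`,
`stub_poincare` ⇒ `stub_core`) and the analytic reduction (`analyticReduction`) are glued by
bookkeeping: given `C` from the reduction take `c₀ ≤ 1/8` from the core at the same `C`; for
`M ≥ 1`, `εM ≤ c₀` gives `8εM ≤ 1`, `ε ≤ c₀/M` and `log(1/ε) ≥ log M + log(1/c₀)`, so the bracket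
of the reduction dominates `(log M + log(1/c₀) − C)‖a‖² − ⟨S_M a,a⟩ − (c₀/M)·archShadow(a) ≥ 0`;
`M = 0` is `Q(0) = 0` (`weilQuadratic_zero`). -/
theorem CombSubcritical_of :
    Summit.RiemannHypothesis.RiemannHypothesis.Theses.WeilComb.CombSubcritical := by
  have hcore := stub_core stub_identity stub_poincare
  obtain ⟨C, hC⟩ := analyticReduction
  obtain ⟨c₀, hc₀, hc₀8, hK⟩ := hcore C
  refine ⟨c₀, hc₀, ?_⟩
  intro φ hφ hsupp ε hε M a hεM
  rcases Nat.eq_zero_or_pos M with hM0 | hMpos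
  · -- `M = 0`: the comb is the zero function and `Q(0) = 0`
    subst hM0
    have h0 : (fun x : ℝ => ∑ m ∈ Finset.Icc 1 0,
        a m * ((ε : ℂ)⁻¹ * φ ((x - Real.log (m : ℝ)) / ε))) = 0 := by
      funext x
      simp
    rw [h0, weilQuadratic_zero]
    simp
  · have hM1 : 1 ≤ M := hMpos
    have hMr : (1 : ℝ) ≤ (M : ℝ) := by exact_mod_cast hM1
    have hMpos' : (0 : ℝ) < (M : ℝ) := by linarith
    -- uses `ε·M ≤ c₀` (i): `8εM ≤ 8c₀ ≤ 1`
    have h8 : 8 * ε * M ≤ 1 := by nlinarith [hεM, hc₀8]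
    have hR := hC φ hφ hsupp ε hε M a hM1 h8
    have hKM := hK M a hM1
    -- uses `ε·M ≤ c₀` (ii): `ε ≤ c₀ / M` pays the archimedean shadow
    have hεle : ε ≤ c₀ / M := by
      rw [le_div_iff₀ hMpos']
      exact hεM
    -- uses `ε·M ≤ c₀` (iii): the budget `log(1/ε) ≥ log M + log(1/c₀)`
    have hlog : Real.log M + Real.log (1 / c₀) ≤ Real.log (1 / ε) := by
      have e1 : Real.log M + Real.log (1 / c₀) = Real.log (M / c₀) := by
        rw [Real.log_div hMpos'.ne' hc₀.ne', one_div, Real.log_inv]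
        ring
      rw [e1]
      apply Real.log_le_log (by positivity)
      rw [div_le_div_iff₀ hc₀ hε]
      nlinarith [hεM]
    -- names for the five real atoms
    set H : ℝ := 2 * (∑ m ∈ Finset.Icc 1 M, ∑ n ∈ Finset.Icc 1 (M / m),
          ((ArithmeticFunction.vonMangoldt n : ℝ) : ℂ) / (Real.sqrt n : ℂ) * a (n * m) *
            conj (a m)).re with hH
    set L : ℝ := ∑ m ∈ Finset.Icc 1 M, ‖a m‖ ^ 2 with hL
    set S : ℝ := 5 * (∑ m ∈ Finset.Icc 1 M, ‖a m‖ / Real.sqrt m) *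
              (∑ m ∈ Finset.Icc 1 M, ‖a m‖ * Real.sqrt m) +
            2 * (∑ m ∈ Finset.Icc 1 M, ∑ m' ∈ (Finset.Icc 1 M).erase m,
              ‖a m‖ * ‖a m'‖ / |Real.log m - Real.log m'|) +
            2 * (∑ m ∈ Finset.Icc 1 M, ‖a m‖) ^ 2 with hS
    have hS0 : 0 ≤ S := by
      have h1 : 0 ≤ ∑ m ∈ Finset.Icc 1 M, ‖a m‖ / Real.sqrt m :=
        Finset.sum_nonneg fun _ _ => by positivity
      have h2 : 0 ≤ ∑ m ∈ Finset.Icc 1 M, ‖a m‖ * Real.sqrt m :=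
        Finset.sum_nonneg fun _ _ => by positivity
      have h3 : 0 ≤ ∑ m ∈ Finset.Icc 1 M, ∑ m' ∈ (Finset.Icc 1 M).erase m,
          ‖a m‖ * ‖a m'‖ / |Real.log m - Real.log m'| :=
        Finset.sum_nonneg fun _ _ => Finset.sum_nonneg fun _ _ => by positivity
      have h4 : 0 ≤ (∑ m ∈ Finset.Icc 1 M, ‖a m‖) ^ 2 := sq_nonneg _
      rw [hS]
      nlinarith [mul_nonneg h1 h2]
    have hL0 : 0 ≤ L := Finset.sum_nonneg fun _ _ => by positivity
    have hX : 0 ≤ (Real.log (1 / ε) - C) * L - H - ε * S := by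
      have h1 : ε * S ≤ c₀ / M * S := mul_le_mul_of_nonneg_right hεle hS0
      have h2 : (Real.log M + Real.log (1 / c₀) - C) * L ≤ (Real.log (1 / ε) - C) * L :=
        mul_le_mul_of_nonneg_right (by linarith) hL0
      linarith [hKM, h1, h2]
    have hpref : 0 ≤ ε⁻¹ * weilNorm2Sq φ :=
      mul_nonneg (inv_nonneg.2 hε.le) (weilNorm2Sq_nonneg φ)
    exact le_trans (mul_nonneg hpref hX) hR

end Summit.RiemannHypothesis.RiemannHypothesis.Theorems.WeilCombSubcritical

end
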